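/-
Copyright (c) 2026 the pub-hodgecm-mathlib formalisation cell (harness21).  Prover seat hodgecm-mathlib-K2E3-p06 (g4), Track B «K2-LIT», engine E3, unit U4 «Keys»; deal (D61)
LINE LEAD of the open leaf (U4f-χ₁-ram-one), design D-I v2, plan step Z4 (algebra) «THE DETERMINANT OF THE `2×2` INTERTWINING MATRIX AND ITS ADMISSIBLE ROOT» — generic algebra;
2026-09-04.  KERNEL module: THEOREMS ONLY (no definition, no named fact, no `sorry`, no instance, no notation).
-/
import Mathlib.Analysis.Complex.Basic
import Mathlib.Tactic.FieldSimp
import Mathlib.Tactic.Ring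
import Mathlib.Tactic.Linarith
import HarnessLib

/-!
# K2 ∕ E3 «EllipticInputs», unit U4 «Keys» — (U4f-χ₁-ram-one-d0B) step Z4 (algebra): `det M = −(q−1)²q⁻⁴·Y∕(1+Y)² − q⁻³ = −(qY+1)(Y+q)∕(q⁴(1+Y)²)`, AND `|Y| < 1 ⟹ (det M = 0 ⟺ Y = −1∕q)`
# [Keys1984 §7 Thm (2); PAPER-Z3-DepthZeroInert §2 (K2E3-p06 (g4), r01-screened)]

Cell hodgecm-mathlib (D-0151), FLOOR 0, Track B «K2-LIT», engine E3, crux item H413 = stmt-HodgeConjecture-24833 (route `HCCMUnconditional`, no route verbs); target BY NAME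
the OPEN leaf `…K2E3EllipticInputs.U4Keys.sig_K2E3KeysThmTwoContractingRamifiedCharOne` (U4Keys ED. 7), Branch B at depth zero (cand v5 leaf (U4f-χ₁-ram-one-d0B)).  Author K2E3-p06 (g4),
line lead (D61).  `--supports stmt-HodgeConjecture-24833 --as helper`; THEOREMS ONLY.  NOT THE PAYER.

THE POINT.  In Branch B at an inert place of residue cardinality `q` the `(I, χ̃)`-plane of `i(χ₁, 1)` is two-dimensional and reducibility forces the `2×2` matrix
`M = (Λ_a f_b)` of the two intertwining functionals on the two type vectors to be singular; PAPER-Z3 §1–§2 computes `det M = −(q−1)²q⁻⁴·Y∕(1+Y)² − q⁻³` with `Y = χ₁(ϖ)q^{−2s}`, `|Y| < 1`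
(contracting).  THIS FILE is the closing algebra (r01's typing remark R5: «one rational identity in `Y`, `field_simp; ring` after `1 + Y ≠ 0`»): the determinant is
`−(qY+1)(Y+q)∕(q⁴(1+Y)²)` (§1), its zeros are `Y = −1∕q` and `Y = −q` (§2), and in the disc `|Y| < 1 < q` only `Y = −1∕q` survives (§3) — i.e. `q^{−2s} χ₁(ϖ) = −q⁻¹`: `Re s = ½` and
`χ₁(ϖ)q^{−2i Im s} = −1`, Keys' cases (b)–(d) (`χ₁ = η‖·‖^{1∕2}`, `η|_{Fˣ} = ω_{E∕F}`).
* §1 `det_formula_eq` (the rational identity).  * §2 `mul_eq_zero_iff_roots`.  * §3 **`det_eq_zero_iff_of_norm_lt_one`** (`|Y| < 1`, `1 < q` ⟹ (`det = 0 ⟺ Y = −1∕q`)).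
HONEST LABEL: HC_CM is proved only modulo the 7 printed citations (2 remaining named inputs: hLiu418 = stmt-HodgeConjecture-24832, h413 = stmt-HodgeConjecture-24833)
until rung 0 closes; count-neutral — this file does NOT pay the leaf; no printed citation is discharged.

## References
* [Keys1984] D. Keys, *Principal series representations of special unitary groups over local fields*, Compositio Math. 51 (1984), §7 Theorem (2) (the reducibility points `s = ½`,
  `λ|_{Fˣ} = ω`).
* [Rogawski1990] J. Rogawski, Ann. of Math. Stud. 123 (1990), §12.2 (1)–(2) p. 173.
-/

set_option autoImplicit false
-- the mandated namespace has the single-problem summit's repeated segment (`HodgeConjecture.HodgeConjecture`)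
set_option linter.dupNamespace false

namespace Summit.HodgeConjecture.HodgeConjecture.Cruxes.H413.K2E3BranchBDeterminantRoots

/-! ## §1 The rational identity -/

/-- **`−(q−1)²q⁻⁴·Y∕(1+Y)² − q⁻³ = −(qY+1)(Y+q)∕(q⁴(1+Y)²)`** for `q ≠ 0`, `1 + Y ≠ 0` (numerator: `(q−1)²Y + q(1+Y)² = qY² + (q²+1)Y + q = (qY+1)(Y+q)`). [cite: Keys1984, §7 Theorem (2)] -/
theorem det_formula_eq (q Y : ℂ) (hq : q ≠ 0) (hY : 1 + Y ≠ 0) :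
    -(q - 1) ^ 2 * (q ^ 4)⁻¹ * Y * ((1 + Y) ^ 2)⁻¹ - (q ^ 3)⁻¹ = -((q * Y + 1) * (Y + q)) * (q ^ 4 * (1 + Y) ^ 2)⁻¹ := by
  have hq4 : q ^ 4 ≠ 0 := pow_ne_zero 4 hq
  have hq3 : q ^ 3 ≠ 0 := pow_ne_zero 3 hq
  have hY2 : (1 + Y) ^ 2 ≠ 0 := pow_ne_zero 2 hY
  field_simp
  ring

/-! ## §2 The zeros of the numerator -/

/-- `(qY+1)(Y+q) = 0 ⟺ Y = −q⁻¹ ∨ Y = −q` (`q ≠ 0`). [cite: Keys1984, §7 Theorem (2)] -/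
theorem mul_eq_zero_iff_roots (q Y : ℂ) (hq : q ≠ 0) :
    (q * Y + 1) * (Y + q) = 0 ↔ Y = -q⁻¹ ∨ Y = -q := by
  rw [mul_eq_zero]
  refine or_congr ?_ ?_
  · constructor
    · intro h
      have h' : q * Y = -1 := by linear_combination h
      calc Y = q⁻¹ * (q * Y) := by rw [← mul_assoc, inv_mul_cancel₀ hq, one_mul]
        _ = -q⁻¹ := by rw [h', mul_neg_one]
    · intro h
      rw [h, mul_neg, mul_inv_cancel₀ hq]; ring
  · constructor
    · intro h; linear_combination h
    · intro h; rw [h]; ring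

/-! ## §3 The admissible root in the disc `|Y| < 1` -/

/-- **For real `q > 1` and `|Y| < 1`: `det M = 0 ⟺ Y = −1∕q`** — the root `Y = −q` has `|Y| = q > 1` and is excluded; `1 + Y ≠ 0` is automatic.  With `Y = χ₁(ϖ) q^{−2s}` this reads
`Re s = ½`, `χ₁(ϖ) q^{−2 i Im s} = −1`: Keys' reducibility points (b)–(d) of the contracting Branch B at depth zero. [cite: Keys1984, §7 Theorem (2)] [cite: Rogawski1990, §12.2 (1)–(2) p. 173] -/
theorem det_eq_zero_iff_of_norm_lt_one (q : ℝ) (hq : 1 < q) (Y : ℂ) (hY : ‖Y‖ < 1) :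
    -((q : ℂ) - 1) ^ 2 * ((q : ℂ) ^ 4)⁻¹ * Y * ((1 + Y) ^ 2)⁻¹ - ((q : ℂ) ^ 3)⁻¹ = 0 ↔ Y = -(q : ℂ)⁻¹ := by
  have hq0 : (q : ℂ) ≠ 0 := by exact_mod_cast (ne_of_gt (lt_trans zero_lt_one hq))
  have hY1 : 1 + Y ≠ 0 := by
    intro h
    have hYeq : Y = -1 := by linear_combination h
    rw [hYeq, norm_neg, norm_one] at hY
    exact lt_irrefl _ hY
  rw [det_formula_eq (q : ℂ) Y hq0 hY1, mul_eq_zero, neg_eq_zero, inv_eq_zero, mul_eq_zero_iff_roots (q : ℂ) Y hq0]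
  have hden : (q : ℂ) ^ 4 * (1 + Y) ^ 2 ≠ 0 := mul_ne_zero (pow_ne_zero 4 hq0) (pow_ne_zero 2 hY1)
  constructor
  · rintro ((h | h) | h)
    · exact h
    · exfalso
      rw [h, norm_neg, Complex.norm_real, Real.norm_eq_abs, abs_of_pos (lt_trans zero_lt_one hq)] at hY
      exact lt_irrefl _ (lt_trans hY hq)
    · exact absurd h hden
  · intro h
    exact Or.inl (Or.inl h)

end Summit.HodgeConjecture.HodgeConjecture.Cruxes.H413.K2E3BranchBDeterminantRoots
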